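/-
Copyright (c) 2026 the pub-hodgecm-mathlib formalisation cell (harness21).  Prover seat hodgecm-mathlib-K2E3-p25 (g3) (L4 architect), HCML Track B «K2-LIT» ∕ h413
(`stmt-HodgeConjecture-24833`).  NR-1′ «LeThree SWEEP» (director s1979∕s1980): the row-12 chain of unit U12 RE-READ on the narrowed cone `2 ≤ N ≤ 3`, `v` non-split
(row-shaped hypotheses and conclusions narrowed token for token; proofs = the ★ original's, pointwise) — SAME NAMES, new namespace.  2026-09-04.
-/
import Summits.HodgeConjecture.HodgeConjecture.Theorems.K2E3NormalizedCharBddNearSemisimpleTwoOfIdentity   -- ★ p855904 (this seat): `normalizedCharBddNear_of_val_eq_smul_one_of_one`; ★ p855865 centre scalar; ★ p855779 lossless; ★ p855019 regular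
import Literature.NumberTheory.Automorphic.LocalIrrepAdmissible                                          -- ★ named fact `UnitaryGroup.LocalIrrepAdmissible` (socket U12-g's body)
import HarnessLib
import Summits.HodgeConjecture.HodgeConjecture.Theorems.K2E3NormalizedCharBddNearSemisimpleOfIdentityDescent   -- ★ the original: every non-letter lemma REUSED by qualified name
import Summits.HodgeConjecture.HodgeConjecture.Theorems.K2E3CharLettersLeThreeDefs   -- NR-1′ root: hHC₃ ∕ hHCB₃

/-!
# NR-1′ twin — ★ `K2E3NormalizedCharBddNearSemisimpleOfIdentityDescent` RE-READ on the narrowed cone (`2 ≤ N ≤ 3`, `v` non-split)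

Cell `pub/hodgecm-mathlib`, crux H413 = `stmt-HodgeConjecture-24833`, line L4 `stub_StCharTS`; director rulings NR-1′ (s1979) ∕ «GO — LeThree SWEEP» (s1980); architect memo
`K2/K2E3-p25/g3/NR1-narrowing-cone.K2E3-p25-g3.md`; K2E3-audit1 (g0) NR-1′ BOX #22∕#23 consequence «MAIN₃ must supply `hd` = U12-d at `2 ≤ N ≤ 3`, `v` non-split».
THEOREMS ONLY; count-neutral helper (`--supports stmt-HodgeConjecture-24833 --as helper`).  The two ★ heads of `K2E3NormalizedCharBddNearSemisimpleOfIdentityDescent`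
(U12-d `normalizedCharBddNearSemisimple_of_identity_of_descent` and U12-d₁ `normalizedCharBddOnCayleySlice_of_identity_of_descent` from (U12-g) + (12-Id) + (12-D))
with the row-shaped hypotheses (12-Id) `hId`, (12-D) `hD` AND the conclusion narrowed token for token: `(N : ℕ) (H : …)` ↦ `(N : ℕ), 2 ≤ N → N ≤ 3 → ∀ (H : …)` and
`(∀ w : PlacesOver L v, IsCMField.complexConj L • w.1 = w.1) →` inserted after the place binder `v`; (U12-g) `hg` unchanged (★ for every `N`).  Proofs = the ★ bodies
(pointwise in `(L, N, H, v)`: the extra arguments `hN2 hN3` ∕ `hns` are threaded to `hId` ∕ `hD` at the same point); every lemma of the original's cone is used BY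
QUALIFIED NAME.  No new mathematics.  The original ★ declarations are untouched.  Consumer: the NR-1′ glue twin `K2E3NormalizedCharBddOnCayleySliceOfLieCoreFixedLeThree`
and U12 MAIN₃ (row 12₃ ∕ U12-d₁₃ ties, dealer's pen).

HONEST LABEL: HC_CM is proved only modulo the 7 printed citations (2 remaining named inputs: hLiu418 = `stmt-HodgeConjecture-24832`, h413 = `stmt-HodgeConjecture-24833`) until rung 0
closes; count-neutral helper; REL ≠ ★.

## References
* [Rogawski1990] J. D. Rogawski, *Automorphic Representations of Unitary Groups in Three Variables* (1990), §1.6 p. 5; §4.9 p. 54; §12.5–12.7.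
* [HarishChandra1999AdmissibleDistributions] Harish-Chandra, *Admissible Invariant Distributions on Reductive p-adic Groups*, ULS 16 (1999), Thm. 16.3.
-/

set_option autoImplicit false
set_option linter.dupNamespace false   -- `Summit.HodgeConjecture.HodgeConjecture.…` (D-0017 nested layout; lakefile exemption for Summits)

noncomputable section

open NumberField IsDedekindDomain MeasureTheory Measure Filter Topology
open scoped Matrix MatrixGroups NNReal
open Literature.NumberTheory.Rogawski1990 Literature.NumberTheory.Automorphic Literature.NumberTheory.Automorphic.UnitaryGroup
open Summit.HodgeConjecture.HodgeConjecture.Cruxes.H413.K2E3CharLocIntNearSemisimpleTwoOfIdentity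
open Summit.HodgeConjecture.HodgeConjecture.Cruxes.H413.K2E3NormalizedCharBddNearSemisimpleRegular
open Summit.HodgeConjecture.HodgeConjecture.Cruxes.H413.K2E3NormalizedCharBddOnCayleySliceOfNear
open Summit.HodgeConjecture.HodgeConjecture.Cruxes.H413.K2E3LocalUnitaryCenterScalar
open Summit.HodgeConjecture.HodgeConjecture.Cruxes.H413.K2E3NormalizedCharBddNearSemisimpleTwoOfIdentity

open Summit.HodgeConjecture.HodgeConjecture.Cruxes.H413.K2E3CharLettersLeThreeDefs

namespace Summit.HodgeConjecture.HodgeConjecture.Cruxes.H413.K2E3NormalizedCharBddNearSemisimpleOfIdentityDescentLeThree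

set_option maxHeartbeats 1600000 in
set_option synthInstance.maxHeartbeats 400000 in
open scoped Classical in
/-- **SOCKET U12-d FOR EVERY `N` FROM (U12-g) + (12-Id) + (12-D).**  `hg` = the body of socket U12-g `sig_K2E3LocalIrrepAdmissible` verbatim; `hId` = U12-d's bytes
at the point `1` (no `s`, no semisimplicity); `hD` = U12-d's bytes with `¬ IsRegularElt s →` and `s ∉ Z(G) →` inserted after the semisimplicity of `s`; conclusion
= U12-d `sig_K2E3NormalizedCharBddNearSemisimple` (ED. 5 :261) verbatim.  Proof = the trichotomy (r)∕(z)∕(d) of the module docstring: ★ p855019 at regular `s`;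
at central `s`, ★ p855865 (scalar), `hg` (admissibility), ★ p855904 §2 with `hId`; otherwise `hD`.
[cite: HarishChandra1999AdmissibleDistributions, Thm. 16.3 p. 77, §18 pp. 78–79, §21 p. 87] [cite: Rogawski1990, §12.7 p. 192] -/
theorem normalizedCharBddNearSemisimple_of_identity_of_descent
    (hg : ∀ (L : Type) [Field L] [NumberField L] [IsCMField L] (N : ℕ) (H : Matrix (Fin N) (Fin N) L), UnitaryGroup.LocalIrrepAdmissible L N H)
    (hId : ∀ (L : Type) [Field L] [NumberField L] [IsCMField L] (N : ℕ), 2 ≤ N → N ≤ 3 → ∀ (H : Matrix (Fin N) (Fin N) L),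
      (H.map (cmConjRingHom L))ᵀ = H → H.det ≠ 0 →
      ∀ (v : HeightOneSpectrum (𝓞 ↥(maximalRealSubfield L))), (∀ w : PlacesOver L v, IsCMField.complexConj L • w.1 = w.1) → ∀
        [MeasurableSpace ((UnitaryGroup.cmDatum L N H).Local v)] [BorelSpace ((UnitaryGroup.cmDatum L N H).Local v)]
        (μ : Measure ((UnitaryGroup.cmDatum L N H).Local v)) [μ.IsHaarMeasure]
        (c : IrrClass ((UnitaryGroup.cmDatum L N H).Local v)) (Θ : (UnitaryGroup.cmDatum L N H).Local v → ℂ),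
        LocallyIntegrable Θ μ →
        (∀ x : (UnitaryGroup.cmDatum L N H).Local v,
          IsRegularElt (x.val : GL (Fin N) (UnitaryGroup.LocalRing L v)) → ∀ᶠ y in 𝓝 x, Θ y = Θ x) →
        (∀ φ : (UnitaryGroup.cmDatum L N H).Local v → ℂ, IsLocSmooth φ → c.smoothTrace μ φ = ∫ x, φ x * Θ x ∂μ) →
        ∃ U : Set ((UnitaryGroup.cmDatum L N H).Local v), IsOpen U ∧ (1 : (UnitaryGroup.cmDatum L N H).Local v) ∈ U ∧
        ∃ B : ℝ, ∀ g ∈ U, ∀ u : (UnitaryGroup.LocalRing L v)ˣ,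
          (u : UnitaryGroup.LocalRing L v) *
              (((g.val : GL (Fin N) (UnitaryGroup.LocalRing L v)).val : Matrix (Fin N) (Fin N) (UnitaryGroup.LocalRing L v)).det) ^ (N - 1) =
            (((g.val : GL (Fin N) (UnitaryGroup.LocalRing L v)).val : Matrix (Fin N) (Fin N) (UnitaryGroup.LocalRing L v)).charpoly).discr →
          ((NNReal.sqrt (NNReal.sqrt (unitModulusChar (UnitaryGroup.LocalRing L v) u)) : ℝ≥0) : ℝ) * ‖Θ g‖ ≤ B)
    (hD : ∀ (L : Type) [Field L] [NumberField L] [IsCMField L] (N : ℕ), 2 ≤ N → N ≤ 3 → ∀ (H : Matrix (Fin N) (Fin N) L),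
      (H.map (cmConjRingHom L))ᵀ = H → H.det ≠ 0 →
      ∀ (v : HeightOneSpectrum (𝓞 ↥(maximalRealSubfield L))), (∀ w : PlacesOver L v, IsCMField.complexConj L • w.1 = w.1) → ∀
        [MeasurableSpace ((UnitaryGroup.cmDatum L N H).Local v)] [BorelSpace ((UnitaryGroup.cmDatum L N H).Local v)]
        (μ : Measure ((UnitaryGroup.cmDatum L N H).Local v)) [μ.IsHaarMeasure]
        (c : IrrClass ((UnitaryGroup.cmDatum L N H).Local v)) (Θ : (UnitaryGroup.cmDatum L N H).Local v → ℂ),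
        LocallyIntegrable Θ μ →
        (∀ x : (UnitaryGroup.cmDatum L N H).Local v,
          IsRegularElt (x.val : GL (Fin N) (UnitaryGroup.LocalRing L v)) → ∀ᶠ y in 𝓝 x, Θ y = Θ x) →
        (∀ φ : (UnitaryGroup.cmDatum L N H).Local v → ℂ, IsLocSmooth φ → c.smoothTrace μ φ = ∫ x, φ x * Θ x ∂μ) →
      ∀ s : (UnitaryGroup.cmDatum L N H).Local v, Module.End.IsSemisimple (Matrix.toLin' ((s.val : GL (Fin N) (UnitaryGroup.LocalRing L v)).val : Matrix (Fin N) (Fin N) (UnitaryGroup.LocalRing L v))) →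
        ¬ IsRegularElt (s.val : GL (Fin N) (UnitaryGroup.LocalRing L v)) → s ∉ Subgroup.center ((UnitaryGroup.cmDatum L N H).Local v) →
        ∃ U : Set ((UnitaryGroup.cmDatum L N H).Local v), IsOpen U ∧ s ∈ U ∧
        ∃ B : ℝ, ∀ g ∈ U, ∀ u : (UnitaryGroup.LocalRing L v)ˣ,
          (u : UnitaryGroup.LocalRing L v) *
              (((g.val : GL (Fin N) (UnitaryGroup.LocalRing L v)).val : Matrix (Fin N) (Fin N) (UnitaryGroup.LocalRing L v)).det) ^ (N - 1) =
            (((g.val : GL (Fin N) (UnitaryGroup.LocalRing L v)).val : Matrix (Fin N) (Fin N) (UnitaryGroup.LocalRing L v)).charpoly).discr →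
          ((NNReal.sqrt (NNReal.sqrt (unitModulusChar (UnitaryGroup.LocalRing L v) u)) : ℝ≥0) : ℝ) * ‖Θ g‖ ≤ B) :
  ∀ (L : Type) [Field L] [NumberField L] [IsCMField L] (N : ℕ), 2 ≤ N → N ≤ 3 → ∀ (H : Matrix (Fin N) (Fin N) L),
    (H.map (cmConjRingHom L))ᵀ = H → H.det ≠ 0 →
    ∀ (v : HeightOneSpectrum (𝓞 ↥(maximalRealSubfield L))), (∀ w : PlacesOver L v, IsCMField.complexConj L • w.1 = w.1) → ∀
      [MeasurableSpace ((UnitaryGroup.cmDatum L N H).Local v)] [BorelSpace ((UnitaryGroup.cmDatum L N H).Local v)]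
      (μ : Measure ((UnitaryGroup.cmDatum L N H).Local v)) [μ.IsHaarMeasure]
      (c : IrrClass ((UnitaryGroup.cmDatum L N H).Local v)) (Θ : (UnitaryGroup.cmDatum L N H).Local v → ℂ),
      LocallyIntegrable Θ μ →
      (∀ x : (UnitaryGroup.cmDatum L N H).Local v,
        IsRegularElt (x.val : GL (Fin N) (UnitaryGroup.LocalRing L v)) → ∀ᶠ y in 𝓝 x, Θ y = Θ x) →
      (∀ φ : (UnitaryGroup.cmDatum L N H).Local v → ℂ, IsLocSmooth φ → c.smoothTrace μ φ = ∫ x, φ x * Θ x ∂μ) →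
    ∀ s : (UnitaryGroup.cmDatum L N H).Local v, Module.End.IsSemisimple (Matrix.toLin' ((s.val : GL (Fin N) (UnitaryGroup.LocalRing L v)).val : Matrix (Fin N) (Fin N) (UnitaryGroup.LocalRing L v))) →
      ∃ U : Set ((UnitaryGroup.cmDatum L N H).Local v), IsOpen U ∧ s ∈ U ∧
      ∃ B : ℝ, ∀ g ∈ U, ∀ u : (UnitaryGroup.LocalRing L v)ˣ,
        (u : UnitaryGroup.LocalRing L v) *
            (((g.val : GL (Fin N) (UnitaryGroup.LocalRing L v)).val : Matrix (Fin N) (Fin N) (UnitaryGroup.LocalRing L v)).det) ^ (N - 1) =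
          (((g.val : GL (Fin N) (UnitaryGroup.LocalRing L v)).val : Matrix (Fin N) (Fin N) (UnitaryGroup.LocalRing L v)).charpoly).discr →
        ((NNReal.sqrt (NNReal.sqrt (unitModulusChar (UnitaryGroup.LocalRing L v) u)) : ℝ≥0) : ℝ) * ‖Θ g‖ ≤ B := by
  intro L _ _ _ N hN2 hN3 H hH hHd v hns _ _ μ _ c Θ hli hloc hrep s hss
  by_cases hreg : IsRegularElt (s.val : GL (Fin N) (UnitaryGroup.LocalRing L v))
  · exact normalizedCharBddNear_of_isRegularElt L N H hH hHd v μ c Θ hli hloc hrep s hreg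
  · by_cases hcen : s ∈ Subgroup.center ((UnitaryGroup.cmDatum L N H).Local v)
    · -- central: scalar, admissible, translate the statement at `1`
      obtain ⟨a, ha⟩ := exists_val_eq_smul_one_of_mem_center L N H v hH hHd hcen
      have hadm : c.IsAdmissible := hg L N H hH (isUnit_iff_ne_zero.2 hHd) v c
      have h1 := hId L N hN2 hN3 H hH hHd v hns μ c Θ hli hloc hrep
      induction c using IrrClass.ind with
      | h r =>
        exact normalizedCharBddNear_of_val_eq_smul_one_of_one L N H v μ r ((IrrClass.isAdmissible_mk r).1 hadm) Θ hloc hrep s a ha h1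
    · exact hD L N hN2 hN3 H hH hHd v hns μ c Θ hli hloc hrep s hss hreg hcen

set_option maxHeartbeats 1600000 in
set_option synthInstance.maxHeartbeats 400000 in
open scoped Classical in
/-- **SUB-SOCKET U12-d₁ FOR EVERY `N` FROM (U12-g) + (12-Id) + (12-D)**: `normalizedCharBddNearSemisimple_of_identity_of_descent` followed by the lossless transport
★ `normalizedCharBddOnCayleySlice_of_near`; conclusion = `sig_K2E3NormalizedCharBddOnCayleySlice` (ED. 5 :214) verbatim.
[cite: HarishChandra1999AdmissibleDistributions, Thm. 16.3 p. 77, §18 pp. 78–79] [cite: Rogawski1990, §12.7 p. 192] -/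
theorem normalizedCharBddOnCayleySlice_of_identity_of_descent
    (hg : ∀ (L : Type) [Field L] [NumberField L] [IsCMField L] (N : ℕ) (H : Matrix (Fin N) (Fin N) L), UnitaryGroup.LocalIrrepAdmissible L N H)
    (hId : ∀ (L : Type) [Field L] [NumberField L] [IsCMField L] (N : ℕ), 2 ≤ N → N ≤ 3 → ∀ (H : Matrix (Fin N) (Fin N) L),
      (H.map (cmConjRingHom L))ᵀ = H → H.det ≠ 0 →
      ∀ (v : HeightOneSpectrum (𝓞 ↥(maximalRealSubfield L))), (∀ w : PlacesOver L v, IsCMField.complexConj L • w.1 = w.1) → ∀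
        [MeasurableSpace ((UnitaryGroup.cmDatum L N H).Local v)] [BorelSpace ((UnitaryGroup.cmDatum L N H).Local v)]
        (μ : Measure ((UnitaryGroup.cmDatum L N H).Local v)) [μ.IsHaarMeasure]
        (c : IrrClass ((UnitaryGroup.cmDatum L N H).Local v)) (Θ : (UnitaryGroup.cmDatum L N H).Local v → ℂ),
        LocallyIntegrable Θ μ →
        (∀ x : (UnitaryGroup.cmDatum L N H).Local v,
          IsRegularElt (x.val : GL (Fin N) (UnitaryGroup.LocalRing L v)) → ∀ᶠ y in 𝓝 x, Θ y = Θ x) →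
        (∀ φ : (UnitaryGroup.cmDatum L N H).Local v → ℂ, IsLocSmooth φ → c.smoothTrace μ φ = ∫ x, φ x * Θ x ∂μ) →
        ∃ U : Set ((UnitaryGroup.cmDatum L N H).Local v), IsOpen U ∧ (1 : (UnitaryGroup.cmDatum L N H).Local v) ∈ U ∧
        ∃ B : ℝ, ∀ g ∈ U, ∀ u : (UnitaryGroup.LocalRing L v)ˣ,
          (u : UnitaryGroup.LocalRing L v) *
              (((g.val : GL (Fin N) (UnitaryGroup.LocalRing L v)).val : Matrix (Fin N) (Fin N) (UnitaryGroup.LocalRing L v)).det) ^ (N - 1) =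
            (((g.val : GL (Fin N) (UnitaryGroup.LocalRing L v)).val : Matrix (Fin N) (Fin N) (UnitaryGroup.LocalRing L v)).charpoly).discr →
          ((NNReal.sqrt (NNReal.sqrt (unitModulusChar (UnitaryGroup.LocalRing L v) u)) : ℝ≥0) : ℝ) * ‖Θ g‖ ≤ B)
    (hD : ∀ (L : Type) [Field L] [NumberField L] [IsCMField L] (N : ℕ), 2 ≤ N → N ≤ 3 → ∀ (H : Matrix (Fin N) (Fin N) L),
      (H.map (cmConjRingHom L))ᵀ = H → H.det ≠ 0 →
      ∀ (v : HeightOneSpectrum (𝓞 ↥(maximalRealSubfield L))), (∀ w : PlacesOver L v, IsCMField.complexConj L • w.1 = w.1) → ∀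
        [MeasurableSpace ((UnitaryGroup.cmDatum L N H).Local v)] [BorelSpace ((UnitaryGroup.cmDatum L N H).Local v)]
        (μ : Measure ((UnitaryGroup.cmDatum L N H).Local v)) [μ.IsHaarMeasure]
        (c : IrrClass ((UnitaryGroup.cmDatum L N H).Local v)) (Θ : (UnitaryGroup.cmDatum L N H).Local v → ℂ),
        LocallyIntegrable Θ μ →
        (∀ x : (UnitaryGroup.cmDatum L N H).Local v,
          IsRegularElt (x.val : GL (Fin N) (UnitaryGroup.LocalRing L v)) → ∀ᶠ y in 𝓝 x, Θ y = Θ x) →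
        (∀ φ : (UnitaryGroup.cmDatum L N H).Local v → ℂ, IsLocSmooth φ → c.smoothTrace μ φ = ∫ x, φ x * Θ x ∂μ) →
      ∀ s : (UnitaryGroup.cmDatum L N H).Local v, Module.End.IsSemisimple (Matrix.toLin' ((s.val : GL (Fin N) (UnitaryGroup.LocalRing L v)).val : Matrix (Fin N) (Fin N) (UnitaryGroup.LocalRing L v))) →
        ¬ IsRegularElt (s.val : GL (Fin N) (UnitaryGroup.LocalRing L v)) → s ∉ Subgroup.center ((UnitaryGroup.cmDatum L N H).Local v) →
        ∃ U : Set ((UnitaryGroup.cmDatum L N H).Local v), IsOpen U ∧ s ∈ U ∧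
        ∃ B : ℝ, ∀ g ∈ U, ∀ u : (UnitaryGroup.LocalRing L v)ˣ,
          (u : UnitaryGroup.LocalRing L v) *
              (((g.val : GL (Fin N) (UnitaryGroup.LocalRing L v)).val : Matrix (Fin N) (Fin N) (UnitaryGroup.LocalRing L v)).det) ^ (N - 1) =
            (((g.val : GL (Fin N) (UnitaryGroup.LocalRing L v)).val : Matrix (Fin N) (Fin N) (UnitaryGroup.LocalRing L v)).charpoly).discr →
          ((NNReal.sqrt (NNReal.sqrt (unitModulusChar (UnitaryGroup.LocalRing L v) u)) : ℝ≥0) : ℝ) * ‖Θ g‖ ≤ B) :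
  ∀ (L : Type) [Field L] [NumberField L] [IsCMField L] (N : ℕ), 2 ≤ N → N ≤ 3 → ∀ (H : Matrix (Fin N) (Fin N) L),
    (H.map (cmConjRingHom L))ᵀ = H → H.det ≠ 0 →
    ∀ (v : HeightOneSpectrum (𝓞 ↥(maximalRealSubfield L))), (∀ w : PlacesOver L v, IsCMField.complexConj L • w.1 = w.1) → ∀
      [MeasurableSpace ((UnitaryGroup.cmDatum L N H).Local v)] [BorelSpace ((UnitaryGroup.cmDatum L N H).Local v)]
      (μ : Measure ((UnitaryGroup.cmDatum L N H).Local v)) [μ.IsHaarMeasure]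
      (c : IrrClass ((UnitaryGroup.cmDatum L N H).Local v)) (Θ : (UnitaryGroup.cmDatum L N H).Local v → ℂ),
      LocallyIntegrable Θ μ →
      (∀ x : (UnitaryGroup.cmDatum L N H).Local v,
        IsRegularElt (x.val : GL (Fin N) (UnitaryGroup.LocalRing L v)) → ∀ᶠ y in 𝓝 x, Θ y = Θ x) →
      (∀ φ : (UnitaryGroup.cmDatum L N H).Local v → ℂ, IsLocSmooth φ → c.smoothTrace μ φ = ∫ x, φ x * Θ x ∂μ) →
    ∀ s : (UnitaryGroup.cmDatum L N H).Local v, Module.End.IsSemisimple (Matrix.toLin' ((s.val : GL (Fin N) (UnitaryGroup.LocalRing L v)).val : Matrix (Fin N) (Fin N) (UnitaryGroup.LocalRing L v))) →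
      ∃ V : Set (Matrix (Fin N) (Fin N) (UnitaryGroup.LocalRing L v)), V ∈ 𝓝 (0 : Matrix (Fin N) (Fin N) (UnitaryGroup.LocalRing L v)) ∧
      ∃ B : ℝ, ∀ y : (UnitaryGroup.cmDatum L N H).Local v,
        (∃ Y ∈ V, (Y.map (UnitaryGroup.conjLocal L (IsCMField.complexConj L) v))ᵀ * ((UnitaryGroup.adelicForm L N H).map (UnitaryGroup.adeleToLocal L v)) = -(((UnitaryGroup.adelicForm L N H).map (UnitaryGroup.adeleToLocal L v)) * Y) ∧
          ((s.val : GL (Fin N) (UnitaryGroup.LocalRing L v)).val : Matrix (Fin N) (Fin N) (UnitaryGroup.LocalRing L v)) * Y = Y * ((s.val : GL (Fin N) (UnitaryGroup.LocalRing L v)).val : Matrix (Fin N) (Fin N) (UnitaryGroup.LocalRing L v)) ∧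
          IsUnit (1 - Y) ∧ IsUnit (1 + Y) ∧
          ((y.val : GL (Fin N) (UnitaryGroup.LocalRing L v)).val : Matrix (Fin N) (Fin N) (UnitaryGroup.LocalRing L v)) = ((s.val : GL (Fin N) (UnitaryGroup.LocalRing L v)).val : Matrix (Fin N) (Fin N) (UnitaryGroup.LocalRing L v)) * ((1 + Y) * (1 - Y)⁻¹)) →
        ∀ u : (UnitaryGroup.LocalRing L v)ˣ,
        (u : UnitaryGroup.LocalRing L v) *
            (((y.val : GL (Fin N) (UnitaryGroup.LocalRing L v)).val : Matrix (Fin N) (Fin N) (UnitaryGroup.LocalRing L v)).det) ^ (N - 1) =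
          (((y.val : GL (Fin N) (UnitaryGroup.LocalRing L v)).val : Matrix (Fin N) (Fin N) (UnitaryGroup.LocalRing L v)).charpoly).discr →
        ((NNReal.sqrt (NNReal.sqrt (unitModulusChar (UnitaryGroup.LocalRing L v) u)) : ℝ≥0) : ℝ) * ‖Θ y‖ ≤ B := by
  intro L _ _ _ N hN2 hN3 H hH hHd v hns _ _ μ _ c Θ hli hloc hrep s hss
  exact normalizedCharBddOnCayleySlice_of_near L N H v hHd Θ s
    (normalizedCharBddNearSemisimple_of_identity_of_descent hg hId hD L N hN2 hN3 H hH hHd v hns μ c Θ hli hloc hrep s hss)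

end Summit.HodgeConjecture.HodgeConjecture.Cruxes.H413.K2E3NormalizedCharBddNearSemisimpleOfIdentityDescentLeThree

end
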